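import Literature.MathematicalPhysics.QuantumFieldTheory.Balaban1983to89.B5Prop11Lattice
import HarnessLib

/-!
# S2β · `hFlat` road — THE DEPTH-UNIFORM LINEAR FLAT FLOOR IS PRINT's [Balaban1984PropagatorsI] PROP. 1.1 (1.90), ALREADY KERNEL
# (lit-balaban b05 lineage): its reading on `ker Q` in B5's gauge, and in FINE-LATTICE UNITS at every block side `n`

Cell `ym3-torus` (rung R3 = continuum `SU(2)` Yang–Mills on the three-torus — NOT d = 4, NOT infinite volume, NOT a mass gap, NOT Clay).
Width seat «width 20» `ym3-torus-px20` (gen 19), FREE px helper on crux `stmt-QuantumFields-20520`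
(`Theses.UnitScaleTilt.FluctuationComparisonRegPrIntL`), count-neutral, DEFINITION-FREE; UV3-NODE §62 (this seat) is the LOCATE behind it.

WHY.  The LINEAR core of the depth-uniform flat letter `hFlat` (third hypothesis of ✓`…S2BetaGapOrbitOfStrata.uniformFibreGapOrbit_of_strata_of_flat`;
UV3-NODE §53.5 ∕ §57.3 «`a ∈ ker Q_m ⟹ ‖[a]‖² ≤ C·N²·‖da‖²`, `C` free of the depth `m` and of the volume») is, in the gauge of
[Balaban1984PropagatorsI] §E ∕ [Balaban1984PropagatorsII] (2.7)–(2.12) (gauge functions with vanishing block MEANS, quotiented by `R∂*A = 0`),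
exactly print's Proposition 1.1: «Δ_a = G⁻¹ ≥ γ₀(Δ + I) (1.90) … with a positive constant γ₀ independent of k, T_η, and depending on d only (if we
put a = 1)», `Δ_a = Δ − ∂P∂* + aQ*Q` ((1.69) p. 29), `Q = Q_k` the k-fold block average written as ONE block of side `n = L^k = η⁻¹` with the
straight contour ((1.18) p. 20).  The lit-balaban cell has this IN THE KERNEL, in position space, for EVERY block side `n ≥ 1`, every coarse torus
`M` and every dimension `d`: `B5DeltaA169.smul_LapOne_le_DeltaA` ∕ `B5Prop11Lattice.ineq190_form` (constant `gammaZero d a`, a number of `d` and `a`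
only), with `B5DeltaA169.DeltaA_eq_curl` (`Δ_a = ½·CurlOpᴴCurlOp + GradOp(1 − P)GradOpᴴ + a·Q†Q`).  This file only READS that theorem on
`ker Q ∩ {(1 − P)(GradOpᴴ A) = 0}` (where the two extra forms vanish) and converts the lattice factor `η⁻¹ = n` carried by B5's difference
operators into fine-lattice units: the floor's rate is `n⁻²` — `hFlat`'s `L^{−2(K−J)}` at `n = L^{K−J}` — with ONE constant before `n` and `M`.

WHAT (all over lit-balaban's typed objects `Tor`, `fine`, `QvOp` (1.18), `PcT` (1.26)∕(1.70), `GradOp`∕`CurlOp` (1.2)∕(1.4), `DeltaA` (1.69), `nsq = Σ|·|²`):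
* §1 `CurlOp_eq_smul` (the lattice factor is linear: `CurlOp N c = c • CurlOp N 1`), `nsq_smul`,
  `form_DeltaA_of_kerQ_gauge` (on `QvOp A = 0`, `(1 − PcT)(GradOpᴴA) = 0`: `⟨A, Δ_a A⟩ = ½·Σ|CurlOp A|²`).
* §2 ★ `gammaZero_mul_nsq_le_half_curl` — (1.90) read on `ker Q` in B5's gauge: `γ₀(d,a)·Σ|A|² ≤ ½·Σ|CurlOp_n A|²`, every `n ≥ 1`, `M`, `a > 0`.
* §3 ★★ `linearFlatFloor_fineUnits` — with the UNIT-lattice curl (`CurlOp … 1`; `½Σ` over sites and ordered direction pairs = the sum over plaquettes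
  of `|da(p)|²`): `Σ_b |a_b|² ≤ γ₀(d,1)⁻¹ · n² · (½·Σ|CurlOp_1 a|²)` for every `a ∈ ker Q` in B5's gauge; ★★ `exists_linearFlatFloor_fineUnits` — ONE
  `C > 0` (per dimension) BEFORE `∀ n ≥ 1 ∀ M` (print's quantifier order «independent of k, T_η»).

PRIOR ART IN THE TREE (credit).  The same reading of (1.90) at flat data, in the T⁴ programme's vector-bracket currency (`qWV ≤ (d+1)·Cst(d,a)·(ScV + a·nsqV(Q W))`,
weights `n^d`, gauge projection `projG`), is pub-balaban's NE2 leaf ✓`Summit.QuantumFields.BalabanUV.T4Continuum.VariationalVectorGaugeSliceB5.qWV_le_flat` ∕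
`hPc_flat` («binder-free, k-uniform»); this file is the special case `Q A = 0`, `(1 − P)∂*A = 0` in B5's raw letters with the fine-unit `n²` made explicit — the
form UV3-NODE §53∕§57 speak — and imports only the Literature chain (no `BalabanUV` cone).

HONEST SCOPE.  Bookkeeping over another cell's kernel theorem (credit: lit-balaban ∕ pub-balaban, b05 lineage `B5Prop11Plancherel` → `B5Prop11Inverse` →
`B5Prop11Lower` → `B5DeltaA169` → `B5Prop11Lattice`, and the NE2 leaf above); nothing of Bałaban's analysis is added here.  This is the floor in B5's BLOCK-MEAN gauge
((2.7): `Q′λ = 0`), NOT in the organ's RESIDUAL centre-point pin (`⨅_{w residual}` of the registry letter): passing from one to the other is NOT free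
(UV3-NODE §62.3 (Δ2); §53.10's «+1 pin», §57.3's multiscale potential build the pin in) — so this file does NOT prove `hFlat`'s linear letter in the
cell's currency, let alone `hFlat` (a NONLINEAR statement on `fibre(1) ∩ histGood`; the lane's §57.8 (B)(C)).  `hFlat`, TUBE-REG∘, GAP♯∘
(`stub_uniformFibreGapOrbit`), DET-REP-B, S2β, crux 20520 and `YM3TorusSU2` are NOT proved; no registered stub is closed; the Yang–Mills mass gap is
NOT proved.
References: T. Bałaban, CMP **95** (1984) 17–40 [Balaban1984PropagatorsI] (Prop. 1.1 (1.89)–(1.90) p. 33; (1.69) p. 29; (1.18) p. 20; (1.2) p. 18);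
CMP **96** (1984) 223–250 [Balaban1984PropagatorsII] ((2.7)–(2.12) pp. 224–225).
-/

set_option autoImplicit false

noncomputable section

namespace Summit.QuantumFields.YangMills.Theorems.FluctuationComparisonRegPrIntLS2BetaLinearFlatFloorB5Gauge

open scoped BigOperators Matrix ComplexConjugate ComplexOrder
open Finset Complex Matrix
open Literature.MathematicalPhysics.QuantumFieldTheory.Balaban1983to89
open B5Prop11Plancherel (Tor fine Cst)
open B5Prop11Lower (nsq nsq_nonneg Lap Vb form_LapOne)
open B5Action121 (CurlOp GradOp sdiff shiftS)
open B5Block118 (QvOp)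
open B5Value126 (PcT)
open B5DeltaA169 (DeltaA QvAdj DeltaA_eq_curl)
open B5Prop11Lattice (gammaZero gammaZero_pos ineq190_form)

/-! ## §1 Forms: `Σ|A|² ≤ re⟨A,(Δ+1)A⟩`; the lattice factor of `CurlOp`; `⟨A, Δ_a A⟩` on `ker Q` in B5's gauge -/

section Forms

variable {d : ℕ} (N : Fin d → ℕ) [hN : ∀ μ, NeZero (N μ)]

omit hN in
/-- The lattice factor of the forward difference is linear: `sdiff N c ν = c • sdiff N 1 ν`. [folklore] -/
theorem sdiff_eq_smul (c : ℂ) (ν : Fin d) : sdiff N c ν = c • sdiff N 1 ν := by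
  simp only [B5Action121.sdiff, one_smul]

omit hN in
/-- **The lattice factor of the curl is linear**: `CurlOp N c = c • CurlOp N 1` (B5's `∂` on vector functions carries `ε⁻¹` per difference,
(1.2): «F(p) = ε⁻¹(A(x,y) + …)»). [cite: Balaban1984PropagatorsI, (1.2) p.18] -/
theorem CurlOp_eq_smul (c : ℂ) : CurlOp N c = c • CurlOp N 1 := by
  ext i j
  simp only [CurlOp, sdiff_eq_smul N c, Matrix.smul_apply, smul_eq_mul]
  split_ifs <;> ring

/-- `Σ|c • x|² = ‖c‖²·Σ|x|²`. [folklore] -/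
theorem nsq_smul {m : Type*} [Fintype m] (c : ℂ) (x : m → ℂ) : nsq (c • x) = ‖c‖ ^ 2 * nsq x := by
  simp only [nsq, Pi.smul_apply, smul_eq_mul, norm_mul, mul_pow, Finset.mul_sum]

end Forms

section Lattice

variable {d : ℕ} (n : ℕ) [NeZero n] (M : Fin d → ℕ) [hM : ∀ μ, NeZero (M μ)]

/-- **`⟨A, Δ_a A⟩ = ½·Σ|CurlOp A|²` on `ker Q` in B5's gauge**: when `Q_kA = 0` ((1.18)) and `(1 − P)(∂*A) = 0` (`R∂*A = 0`, `R = I − P`,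
(1.69)∕(1.70); [Balaban1984PropagatorsII] (2.12)), the averaging form `a⟨A,Q*QA⟩` and the gauge form `⟨∂*A, R∂*A⟩` of `Δ_a = ∂*∂ + ∂R∂* + aQ*Q`
vanish and only the curl form `⟨∂A,∂A⟩ = ½Σ|F|²` remains (`B5DeltaA169.DeltaA_eq_curl`).
[cite: Balaban1984PropagatorsI, (1.69) p.29, (1.21) p.21; Balaban1984PropagatorsII, (2.12) p.225] -/
theorem form_DeltaA_of_kerQ_gauge (a : ℝ) (A : Tor (fine n M) × Fin d → ℂ)
    (hQ : QvOp n M *ᵥ A = 0)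
    (hR : (1 - PcT n M (n : ℂ)) *ᵥ ((GradOp (fine n M) (n : ℂ))ᴴ *ᵥ A) = 0) :
    star A ⬝ᵥ (DeltaA n M a *ᵥ A) = (1 / 2 : ℂ) * ((nsq (CurlOp (fine n M) (n : ℂ) *ᵥ A) : ℝ) : ℂ) := by
  rw [DeltaA_eq_curl, Matrix.add_mulVec, Matrix.add_mulVec, dotProduct_add, dotProduct_add]
  have h2 : (GradOp (fine n M) (n : ℂ) * (1 - PcT n M (n : ℂ)) * (GradOp (fine n M) (n : ℂ))ᴴ) *ᵥ A = 0 := by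
    rw [← Matrix.mulVec_mulVec, ← Matrix.mulVec_mulVec, hR, Matrix.mulVec_zero]
  have h3 : ((a : ℂ) • (QvAdj n M * QvOp n M)) *ᵥ A = 0 := by
    rw [Matrix.smul_mulVec, ← Matrix.mulVec_mulVec, hQ, Matrix.mulVec_zero, smul_zero]
  rw [h2, h3]
  simp only [dotProduct_zero, add_zero]
  rw [Matrix.smul_mulVec, dotProduct_smul, B5Action121.form_gram_rect, B5Prop11Lower.star_dotProduct_self, smul_eq_mul]

/-! ## §2 (1.90) READ ON `ker Q` IN B5's GAUGE -/

/-- ★ **[B5] PROP. 1.1 (1.90) ON `ker Q` IN B5's GAUGE**: `γ₀(d,a)·Σ|A|² ≤ ½·Σ|CurlOp_n A|²` for every `A` with `Q_kA = 0` and `R∂*A = 0`, every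
block side `n ≥ 1`, every coarse torus `M`, every `a > 0` — `γ₀ = B5Prop11Lattice.gammaZero d a`, a number of `d` and `a` only (print: «independent
of k, T_η»).  Kernel engine: `B5Prop11Lattice.ineq190_form` (lit-balaban b05 lineage). [cite: Balaban1984PropagatorsI, Prop. 1.1 (1.90) p.33] -/
theorem gammaZero_mul_nsq_le_half_curl (hn : 1 ≤ n) (a : ℝ) (ha : 0 < a) (A : Tor (fine n M) × Fin d → ℂ)
    (hQ : QvOp n M *ᵥ A = 0)
    (hR : (1 - PcT n M (n : ℂ)) *ᵥ ((GradOp (fine n M) (n : ℂ))ᴴ *ᵥ A) = 0) :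
    gammaZero d a * nsq A ≤ (1 / 2 : ℝ) * nsq (CurlOp (fine n M) (n : ℂ) *ᵥ A) := by
  have h190 := ineq190_form n hn M a ha A
  have hform : (star A ⬝ᵥ (DeltaA n M a *ᵥ A)).re = (1 / 2 : ℝ) * nsq (CurlOp (fine n M) (n : ℂ) *ᵥ A) := by
    rw [form_DeltaA_of_kerQ_gauge n M a A hQ hR]
    simp [Complex.mul_re]
  rw [hform] at h190
  -- `Σ|A|² ≤ re⟨A, (Δ + 1)A⟩`: the `I`-part of print's `Δ + I` (`form_LapOne`: `⟨A,(Δ+1)A⟩ = Σ_α Σ|V_αA|²`, `V_none = 1`; this `have` is pub-balaban's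
  -- `VariationalVectorGaugeSliceB5.nsq_le_form_LapOne`, inlined — one copy in the tree)
  have hI : nsq A ≤ (star A ⬝ᵥ ((Lap n M + 1) *ᵥ A)).re := by
    rw [form_LapOne, Complex.ofReal_re, Fintype.sum_option]
    simp only [Vb, Matrix.one_mulVec]
    exact le_add_of_nonneg_right (Finset.sum_nonneg fun _ _ => nsq_nonneg _)
  exact (mul_le_mul_of_nonneg_left hI (gammaZero_pos d a).le).trans h190

/-! ## §3 FINE-LATTICE UNITS: the rate `n⁻²` -/

/-- ★★ **THE DEPTH-UNIFORM LINEAR FLAT FLOOR IN FINE-LATTICE UNITS (B5 gauge)**: for every block side `n ≥ 1`, every coarse torus `M` and every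
bond function `a` on the fine torus `T = Tor (fine n M)` with `Q_k a = 0` and `R∂*a = 0`:
`Σ_b |a_b|² ≤ γ₀(d,1)⁻¹ · n² · (½·Σ_{x,(μ,ν)} |(CurlOp_1 a)(x,μ,ν)|²)` — the right-hand `½Σ` over sites and ORDERED direction pairs of the UNIT-lattice
curl is the sum over plaquettes of `|da(p)|²`, so this is UV3-NODE §53.5∕§57.3's linear letter `‖a‖² ≤ C·N²·‖da‖²` at `N = n`, with `C = γ₀(d,1)⁻¹`
free of `n` and of the volume — IN B5's BLOCK-MEAN GAUGE (not the organ's residual centre-point pin; §62.3 (Δ2)).  Mechanism: §2 at `a = 1` and the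
lattice factor `CurlOp_n = n • CurlOp_1`. [cite: Balaban1984PropagatorsI, Prop. 1.1 (1.90) p.33, (1.18) p.20, (1.2) p.18] -/
theorem linearFlatFloor_fineUnits (hn : 1 ≤ n) (a : Tor (fine n M) × Fin d → ℂ)
    (hQ : QvOp n M *ᵥ a = 0)
    (hR : (1 - PcT n M (n : ℂ)) *ᵥ ((GradOp (fine n M) (n : ℂ))ᴴ *ᵥ a) = 0) :
    nsq a ≤ (gammaZero d 1)⁻¹ * (n : ℝ) ^ 2 * ((1 / 2 : ℝ) * nsq (CurlOp (fine n M) 1 *ᵥ a)) := by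
  have h := gammaZero_mul_nsq_le_half_curl n M hn 1 one_pos a hQ hR
  rw [CurlOp_eq_smul (fine n M) (n : ℂ), Matrix.smul_mulVec, nsq_smul, Complex.norm_natCast] at h
  have hγ := gammaZero_pos d (1 : ℝ)
  have h' : nsq a ≤ (1 / 2 : ℝ) * ((n : ℝ) ^ 2 * nsq (CurlOp (fine n M) 1 *ᵥ a)) / gammaZero d 1 :=
    (le_div_iff₀ hγ).mpr (by simpa only [mul_comm] using h)
  calc nsq a ≤ (1 / 2 : ℝ) * ((n : ℝ) ^ 2 * nsq (CurlOp (fine n M) 1 *ᵥ a)) / gammaZero d 1 := h'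
    _ = (gammaZero d 1)⁻¹ * (n : ℝ) ^ 2 * ((1 / 2 : ℝ) * nsq (CurlOp (fine n M) 1 *ᵥ a)) := by ring

end Lattice

/-- ★★ **ONE CONSTANT BEFORE THE BLOCK SIDE AND THE VOLUME** (print's quantifier order «independent of k, T_η, and depending on d only»): for every
dimension `d` there is `C > 0` such that for EVERY block side `n ≥ 1` (`η = n⁻¹`; `n = L^{K−J}` at depth `K − J`), EVERY coarse torus `M` and every
fine bond function `a` with `Q_k a = 0` in B5's gauge, `Σ_b|a_b|² ≤ C · n² · (½·Σ|CurlOp_1 a|²)` — the depth- and volume-uniform LINEAR flat floor at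
rate `n⁻²` (B5 gauge). [cite: Balaban1984PropagatorsI, Prop. 1.1 (1.90) p.33] -/
theorem exists_linearFlatFloor_fineUnits (d : ℕ) :
    ∃ C : ℝ, 0 < C ∧ ∀ (n : ℕ) [NeZero n], 1 ≤ n → ∀ (M : Fin d → ℕ) [∀ μ, NeZero (M μ)],
      ∀ a : Tor (fine n M) × Fin d → ℂ,
        QvOp n M *ᵥ a = 0 →
        (1 - PcT n M (n : ℂ)) *ᵥ ((GradOp (fine n M) (n : ℂ))ᴴ *ᵥ a) = 0 →
          nsq a ≤ C * (n : ℝ) ^ 2 * ((1 / 2 : ℝ) * nsq (CurlOp (fine n M) 1 *ᵥ a)) :=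
  ⟨(gammaZero d 1)⁻¹, inv_pos.mpr (gammaZero_pos d 1), fun n _ hn M _ a hQ hR =>
    linearFlatFloor_fineUnits n M hn a hQ hR⟩

end Summit.QuantumFields.YangMills.Theorems.FluctuationComparisonRegPrIntLS2BetaLinearFlatFloorB5Gauge

end
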